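import Summits.ResolutionOfSingularities.ResolutionOfSingularities.Theorems.WildConesCampaignW46HypersurfacesCharTwoFreePoints
import Summits.ResolutionOfSingularities.ResolutionOfSingularities.Theorems.WildConesCampaignW46HypersurfacesCharTwoPairFreeCubic
import Summits.ResolutionOfSingularities.ResolutionOfSingularities.Theorems.WildConesCampaignW46ThreefoldsCharTwoFamily

/-!
# [OURS · L1 W4.6, rung (ii) at p = 2] LEAVES FOR THE CENSUS WITNESSES: the surface family
# `z² = x²y + xy^k` (`k` even) — state, multiplicity, pair-freeness, partials `(y^k, x²)`, isolatedness
# `𝔪^{k+1} ≤ (∂a)`, and the POLARS `polar(λ, v) = λ₁v₀² (+ λ₀v₁² if k = 2)` — every field of characteristic 2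

HONEST FRAMING. Everything here is OURS: lemmas about route WildCones' own TYPED point-blow-up dynamics
(`Theorems/WildConesClassicalRegimesDefs.lean`) and the seat's invariants `polarMatrix` (p502936),
`degForm` (p522667). NOTHING here is a statement of the manuscript [Hironaka2017]; no FACT-LIST premise;
AI review is weaker than expert review. Cell res-hironaka (LADDER-RESOLUTION rung L, D-0089), slot W4.6,
seat res-L1-s46-pv-4 (gen 6); host route `WildCones`, crux `ClassicalRegimes`
(stmt-ResolutionOfSingularities-16884; proved). Used by `…HypersurfacesCharTwoCensusWitness.lean` (the
three-tangents witness `k = 2` and the multiple-tangent witness `k = 4` of the corank-two census).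

WHAT IS HERE: coefficient / `MultP` / `¬OrdP` / tangent-cubic lemmas for two-monomial cleaned series
`u^{B₁} + u^{B₂}`; for the family `u^{(2,1)} + u^{(1,k)}`, `k` even: a state exists
(`exists_ser_eq_witness`), `∂₀ = u₁^k`, `∂₁ = u₀²` (`pderiv_e21_add_single`), `𝔪^{k+1} ≤ (u₁^k, u₀²)`,
isolatedness (`isol_of_ser_eq_e21_add_single`), and the polars (`polar_e21_add_single`).

References: [GreuelPfister2026] (context); [Hironaka2017] Th. 16.6 p.84 — role replaced only, under
adjudication; nothing of it is used.
-/

noncomputable section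

-- single-problem summit: the doubled namespace component `ResolutionOfSingularities` is forced
set_option linter.dupNamespace false

open scoped BigOperators Classical

open MvPowerSeries IsLocalRing

open Literature.AlgebraicGeometry.Resolution

namespace Summit.ResolutionOfSingularities.ResolutionOfSingularities.Theorems

namespace CampaignW46.HypersurfacesCharTwo

open WildCones WildCones.MuDropCharTwoOrdP ThreefoldsCharTwo

variable {κ : Type} [Field κ]

/-! ## Generalities on pair-free surface states -/

/-- [OURS · L1 W4.6] For a pair-free state every vector is a kernel vector of the polar matrix. [folklore] -/
theorem vecMul_polarMatrix_of_not_ordP [CharP κ 2] {n : ℕ} {c : (Fin n → ℕ) → κ} (hO : ¬ OrdP 2 n κ c)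
    (v : Fin n → κ) : Matrix.vecMul v (polarMatrix (ser 2 n κ c)) = 0 := by
  rw [polarMatrix_eq_zero_of_not_ordP hO, Matrix.vecMul_zero]

/-- [OURS · L1 W4.6] A sum of two monomials with exponents that are not everywhere even is a cleaned
series of some state, is non-zero of order `≥ 2` when both degrees are `≥ 2` and the exponents differ,
and has no hyperbolic pair when neither exponent is `e_j + e_l` (`j ≠ l`) — packaged for `n = 2`.
[folklore] -/
theorem coeff_monomial_add_monomial {n : ℕ} (B₁ B₂ A : Fin n →₀ ℕ) :
    coeff A ((monomial B₁ (1 : κ) + monomial B₂ 1 : MvPowerSeries (Fin n) κ)) =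
      (if A = B₁ then 1 else 0) + (if A = B₂ then 1 else 0) := by
  rw [map_add, coeff_monomial, coeff_monomial]

/-- [OURS · L1 W4.6] `MultP` for a state whose cleaned series is `u^{B₁} + u^{B₂}` with `B₁ ≠ B₂` of
degrees `≥ 2`. [folklore] -/
theorem multP_of_ser_eq_monomial_add {n : ℕ} {c : (Fin n → ℕ) → κ} {B₁ B₂ : Fin n →₀ ℕ} (hne : B₁ ≠ B₂)
    (h₁ : 2 ≤ B₁.degree) (h₂ : 2 ≤ B₂.degree)
    (hc : ser 2 n κ c = monomial B₁ (1 : κ) + monomial B₂ 1) : MultP 2 n κ c := by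
  rw [multP_iff_ser, hc]
  constructor
  · intro h
    have h1 := congrArg (coeff B₁) h
    rw [coeff_monomial_add_monomial, if_pos rfl, if_neg hne, map_zero, add_zero] at h1
    exact one_ne_zero h1
  · refine nat_le_order fun d hd => ?_
    rw [coeff_monomial_add_monomial]
    have hd₁ : d ≠ B₁ := by rintro rfl; exact absurd h₁ (by exact_mod_cast not_le.mpr hd)
    have hd₂ : d ≠ B₂ := by rintro rfl; exact absurd h₂ (by exact_mod_cast not_le.mpr hd)
    rw [if_neg hd₁, if_neg hd₂, add_zero]

/-- [OURS · L1 W4.6] `¬OrdP` for a state whose cleaned series is `u^{B₁} + u^{B₂}` with both degrees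
`≠ 2`. [folklore] -/
theorem not_ordP_of_ser_eq_monomial_add {n : ℕ} {c : (Fin n → ℕ) → κ} {B₁ B₂ : Fin n →₀ ℕ}
    (h₁ : B₁.degree ≠ 2) (h₂ : B₂.degree ≠ 2)
    (hc : ser 2 n κ c = monomial B₁ (1 : κ) + monomial B₂ 1) : ¬ OrdP 2 n κ c := by
  rw [ordP_two_iff_exists_pair, hc]
  rintro ⟨j, l, -, h⟩
  rw [coeff_monomial_add_monomial] at h
  have hdeg : (Finsupp.single j 1 + Finsupp.single l 1 : Fin n →₀ ℕ).degree = 2 := by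
    rw [map_add, Finsupp.degree_single, Finsupp.degree_single]
  have hB₁ : (Finsupp.single j 1 + Finsupp.single l 1 : Fin n →₀ ℕ) ≠ B₁ := fun h' => h₁ (by rw [← h', hdeg])
  have hB₂ : (Finsupp.single j 1 + Finsupp.single l 1 : Fin n →₀ ℕ) ≠ B₂ := fun h' => h₂ (by rw [← h', hdeg])
  rw [if_neg hB₁, if_neg hB₂, add_zero] at h
  exact h rfl

/-- [OURS · L1 W4.6] The tangent cubic of `u^{B₁} + u^{B₂}` when `|B₁| = 3 ≠ |B₂|`. [folklore] -/
theorem degForm_three_monomial_add {n : ℕ} {B₁ B₂ : Fin n →₀ ℕ} (h₁ : B₁.degree = 3) (h₂ : B₂.degree ≠ 3)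
    (w : Fin n → κ) :
    degForm 3 ((monomial B₁ (1 : κ) + monomial B₂ 1 : MvPowerSeries (Fin n) κ)) w = ∏ s, w s ^ (B₁ s) := by
  rw [degForm_add, degForm_monomial h₁, degForm_monomial_of_ne h₂, one_mul, add_zero]

/-! ## The family `u^{(2,1)} + u^{(1,k)}` (`k` even): `x²y + xy²` (`k = 2`), `x²y + xy⁴` (`k = 4`) -/

/- The three-tangents series is `x²y + xy² = u^{(2,1)} + u^{(1,2)}`, the multiple-tangent series is
`x²y + xy⁴ = u^{(2,1)} + u^{(1,4)}`; both are `u^{(2,1)} + u^{(1,k)}` (`k = 2, 4`), written inline (no definition). -/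

/-- [OURS · L1 W4.6] The exponent `(2,1)` evaluated. [folklore] -/
theorem exp21_apply : (Finsupp.single 0 2 + Finsupp.single 1 1 : Fin 2 →₀ ℕ) 0 = 2 ∧
    (Finsupp.single 0 2 + Finsupp.single 1 1 : Fin 2 →₀ ℕ) 1 = 1 := by
  simp

/-- [OURS · L1 W4.6] The exponent `(2,1)` has degree `3`. [folklore] -/
theorem exp21_degree : (Finsupp.single 0 2 + Finsupp.single 1 1 : Fin 2 →₀ ℕ).degree = 3 := by
  rw [map_add, Finsupp.degree_single, Finsupp.degree_single]

/-- [OURS · L1 W4.6] Both witnesses are cleaned series of states (no monomial with all exponents even).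
[folklore] -/
theorem exists_ser_eq_witness (B₂ : Fin 2 →₀ ℕ) (hB₂ : ¬ 2 ∣ B₂ 0) :
    ∃ c : (Fin 2 → ℕ) → κ,
      ser 2 2 κ c = monomial (Finsupp.single 0 2 + Finsupp.single 1 1 : Fin 2 →₀ ℕ) (1 : κ) + monomial B₂ 1 := by
  refine exists_ser_eq _ fun A hA => ?_
  rw [coeff_monomial_add_monomial]
  have h1 : A ≠ (Finsupp.single 0 2 + Finsupp.single 1 1 : Fin 2 →₀ ℕ) := by
    rintro rfl; have := hA 1; rw [exp21_apply.2] at this; omega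
  have h2 : A ≠ B₂ := by rintro rfl; exact hB₂ (hA 0)
  rw [if_neg h1, if_neg h2, add_zero]

/-! ### Partials, isolatedness, polars -/

/-- [OURS · L1 W4.6] In characteristic two, `∂₀(u^{(2,1)} + u^{(1,k)}) = u₁^k` and
`∂₁(u^{(2,1)} + u^{(1,k)}) = u₀²` for EVEN `k`. [folklore] -/
theorem pderiv_e21_add_single {k : ℕ} [CharP κ 2] (hk : 2 ∣ k) (s : Fin 2) :
    MvPowerSeries.pderiv s ((monomial (Finsupp.single 0 2 + Finsupp.single 1 1 : Fin 2 →₀ ℕ) (1 : κ) +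
      monomial (Finsupp.single 0 1 + Finsupp.single 1 k) 1 : MvPowerSeries (Fin 2) κ)) =
      if s = 0 then monomial (Finsupp.single 1 k) (1 : κ) else monomial (Finsupp.single 0 2) 1 := by
  ext A
  rw [MvPowerSeries.coeff_pderiv, coeff_monomial_add_monomial]
  obtain ⟨k', rfl⟩ := hk
  fin_cases s
  · -- `s = 0`
    simp only [Fin.zero_eta, Fin.isValue, ↓reduceIte, coeff_monomial]
    by_cases hA : A = Finsupp.single 1 (2 * k')
    · subst hA
      have h1 : (Finsupp.single 1 (2 * k') + Finsupp.single 0 1 : Fin 2 →₀ ℕ) ≠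
          Finsupp.single 0 2 + Finsupp.single 1 1 := by
        intro h; have := DFunLike.congr_fun h 0; simp at this
      have h2 : (Finsupp.single 1 (2 * k') + Finsupp.single 0 1 : Fin 2 →₀ ℕ) =
          Finsupp.single 0 1 + Finsupp.single 1 (2 * k') := add_comm _ _
      rw [if_neg h1, if_pos h2, if_pos rfl]
      simp
    · rw [if_neg hA]
      have h2 : (A + Finsupp.single 0 1 : Fin 2 →₀ ℕ) ≠ Finsupp.single 0 1 + Finsupp.single 1 (2 * k') := by
        intro h
        apply hA
        ext x
        have := DFunLike.congr_fun h x
        fin_cases x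
        · simp at this ⊢; omega
        · simp at this ⊢; omega
      rw [if_neg h2, add_zero]
      by_cases h1 : (A + Finsupp.single 0 1 : Fin 2 →₀ ℕ) = (Finsupp.single 0 2 + Finsupp.single 1 1 : Fin 2 →₀ ℕ)
      · rw [if_pos h1]
        have hA0 : A 0 = 1 := by have := DFunLike.congr_fun h1 0; rw [exp21_apply.1] at this; simpa using this
        rw [hA0]
        have : ((1 : ℕ) : κ) + 1 = 0 := by rw [Nat.cast_one]; exact CharTwo.add_self_eq_zero 1
        rw [this, zero_mul]
      · rw [if_neg h1, mul_zero]
  · -- `s = 1`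
    simp only [Fin.mk_one, Fin.isValue, one_ne_zero, ↓reduceIte, coeff_monomial]
    by_cases hA : A = Finsupp.single 0 2
    · subst hA
      have h2 : (Finsupp.single 0 2 + Finsupp.single 1 1 : Fin 2 →₀ ℕ) ≠
          Finsupp.single 0 1 + Finsupp.single 1 (2 * k') := by
        intro h; have := DFunLike.congr_fun h 0; simp at this
      rw [if_pos rfl, if_neg h2, if_pos rfl]
      simp
    · rw [if_neg hA]
      have h1 : (A + Finsupp.single 1 1 : Fin 2 →₀ ℕ) ≠ (Finsupp.single 0 2 + Finsupp.single 1 1 : Fin 2 →₀ ℕ) := by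
        intro h
        apply hA
        ext x
        have := DFunLike.congr_fun h x
        fin_cases x
        · simp at this ⊢; omega
        · simp at this ⊢; omega
      rw [if_neg h1]
      by_cases h2 : (A + Finsupp.single 1 1 : Fin 2 →₀ ℕ) = Finsupp.single 0 1 + Finsupp.single 1 (2 * k')
      · rw [if_pos h2]
        have hA1 : A 1 + 1 = 2 * k' := by
          have := DFunLike.congr_fun h2 1; simpa [Finsupp.single_apply] using this
        have : ((A 1 : κ) + 1) = 0 := by
          have h' : ((A 1 + 1 : ℕ) : κ) = 0 := by
            rw [hA1, Nat.cast_mul, show ((2 : ℕ) : κ) = 0 from CharP.cast_eq_zero κ 2, zero_mul]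
          exact_mod_cast h'
        rw [this, zero_mul]
      · rw [if_neg h2]
        simp

/-- [OURS · L1 W4.6] `𝔪^{k+1} ≤ (u₁^k, u₀²)`: a monomial of degree `k + 1` in two variables is divisible by
`u₀²` or by `u₁^k`. [folklore] -/
theorem maximalIdeal_pow_le_span_pair (k : ℕ) :
    maximalIdeal (MvPowerSeries (Fin 2) κ) ^ (k + 1) ≤
      Ideal.span ({(monomial (Finsupp.single 1 k) (1 : κ) : MvPowerSeries (Fin 2) κ),
        monomial (Finsupp.single 0 2) 1} : Set (MvPowerSeries (Fin 2) κ)) := by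
  rw [Literature.RingTheory.MvPowerSeries.Jets.maximalIdeal_pow_eq_span_monomial, Ideal.span_le]
  rintro _ ⟨e, he, rfl⟩
  change e.degree = k + 1 at he
  change (monomial e (1 : κ) : MvPowerSeries (Fin 2) κ) ∈ _
  have hsum : e.degree = e 0 + e 1 := by rw [degree_eq_sum_univ, Fin.sum_univ_two]
  by_cases h0 : 2 ≤ e 0
  · have hdec : (monomial e (1 : κ) : MvPowerSeries (Fin 2) κ) =
        monomial (e - Finsupp.single 0 2) (1 : κ) * monomial (Finsupp.single 0 2) 1 := by
      rw [monomial_mul_monomial, one_mul, tsub_add_cancel_of_le]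
      intro t
      fin_cases t
      · simpa using h0
      · simp
    rw [hdec]
    exact Ideal.mul_mem_left _ _ (Ideal.subset_span (by simp))
  · have h1 : k ≤ e 1 := by omega
    have hdec : (monomial e (1 : κ) : MvPowerSeries (Fin 2) κ) =
        monomial (e - Finsupp.single 1 k) (1 : κ) * monomial (Finsupp.single 1 k) 1 := by
      rw [monomial_mul_monomial, one_mul, tsub_add_cancel_of_le]
      intro t
      fin_cases t
      · simp
      · simpa using h1
    rw [hdec]
    exact Ideal.mul_mem_left _ _ (Ideal.subset_span (by simp))

/-- [OURS · L1 W4.6] A state with cleaned series `u^{(2,1)} + u^{(1,k)}`, `k` even, is ISOLATED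
(`(∂a) = (u₁^k, u₀²) ⊇ 𝔪^{k+1}`). [folklore] -/
theorem isol_of_ser_eq_e21_add_single [CharP κ 2] {k : ℕ} (hk : 2 ∣ k) {c : (Fin 2 → ℕ) → κ}
    (hc : ser 2 2 κ c = monomial (Finsupp.single 0 2 + Finsupp.single 1 1 : Fin 2 →₀ ℕ) (1 : κ) +
      monomial (Finsupp.single 0 1 + Finsupp.single 1 k) 1) :
    Isol 2 2 κ c := by
  rw [isol_iff_finite_pderiv, hc]
  have hJ : Ideal.span ({(monomial (Finsupp.single 1 k) (1 : κ) : MvPowerSeries (Fin 2) κ),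
        monomial (Finsupp.single 0 2) 1} : Set (MvPowerSeries (Fin 2) κ)) ≤
      Ideal.span (Set.range fun s : Fin 2 => MvPowerSeries.pderiv s
        ((monomial (Finsupp.single 0 2 + Finsupp.single 1 1 : Fin 2 →₀ ℕ) (1 : κ) +
          monomial (Finsupp.single 0 1 + Finsupp.single 1 k) 1 :
          MvPowerSeries (Fin 2) κ))) := by
    rw [Ideal.span_le]
    rintro g hg
    rcases hg with rfl | hg
    · exact Ideal.subset_span ⟨0, by beta_reduce; rw [pderiv_e21_add_single hk]; simp⟩
    · rw [Set.mem_singleton_iff] at hg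
      subst hg
      exact Ideal.subset_span ⟨1, by beta_reduce; rw [pderiv_e21_add_single hk]; simp⟩
  have hle := (maximalIdeal_pow_le_span_pair (κ := κ) k).trans hJ
  haveI := Literature.RingTheory.MvPowerSeries.Jets.finite_quotient_maximalIdeal_pow
    (σ := Fin 2) (K := κ) (k + 1)
  exact Module.Finite.of_surjective (Ideal.Quotient.factorₐ κ hle).toLinearMap
    (Ideal.Quotient.factor_surjective hle)

/-- [OURS · L1 W4.6] THE POLARS of `u^{(2,1)} + u^{(1,k)}` (`k` even): `Σₛ λₛ (∂ₛa)₂(v) = λ₁ v₀²`, plus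
`λ₀ v₁²` when `k = 2`. [folklore] -/
theorem polar_e21_add_single [CharP κ 2] {k : ℕ} (hk : 2 ∣ k) (lam v : Fin 2 → κ) :
    ∑ s, lam s * degForm 2 (MvPowerSeries.pderiv s
      ((monomial (Finsupp.single 0 2 + Finsupp.single 1 1 : Fin 2 →₀ ℕ) (1 : κ) +
        monomial (Finsupp.single 0 1 + Finsupp.single 1 k) 1 :
        MvPowerSeries (Fin 2) κ))) v =
      lam 0 * (if k = 2 then v 1 ^ 2 else 0) + lam 1 * v 0 ^ 2 := by
  rw [Fin.sum_univ_two, pderiv_e21_add_single hk, pderiv_e21_add_single hk, if_pos rfl,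
    if_neg (by decide : (1 : Fin 2) ≠ 0)]
  have hq : degForm 2 (monomial (Finsupp.single (0 : Fin 2) 2) (1 : κ)) v = v 0 ^ 2 := by
    rw [degForm_monomial (by rw [Finsupp.degree_single]), Fin.prod_univ_two]
    simp
  have hk' : degForm 2 (monomial (Finsupp.single (1 : Fin 2) k) (1 : κ)) v = if k = 2 then v 1 ^ 2 else 0 := by
    by_cases hk2 : k = 2
    · subst hk2
      rw [if_pos rfl, degForm_monomial (by rw [Finsupp.degree_single]), Fin.prod_univ_two]
      simp
    · rw [if_neg hk2, degForm_monomial_of_ne (by rw [Finsupp.degree_single]; exact hk2)]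
  rw [hq, hk']

end CampaignW46.HypersurfacesCharTwo

end Summit.ResolutionOfSingularities.ResolutionOfSingularities.Theorems

end
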